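import Mathlib
import Summits.MatrixMultiplication.MatrixMultiplication.Theorems.SnSubsetDichotomyHyperoctahedralThresholdStubPatternTwin

/-!
# The two-core criterion for clean closed rung walks
(crux `SnSubsetDichotomy.HyperoctahedralThreshold`, stmt-MatrixMultiplication-10883, line `refutation-local-symmetry`,
open core `stub_poorRigidCore`; siege seat k17, variation "supply/tip dichotomy"; `--supports` helper,
registered as `stub_twoCoreCriterion`)

Vocabulary of the line: `μ 0, μ 1, μ 2 : Equiv.Perm (Fin n)` are the three colours, `R` is the forbidden set, a RUNG is
a pair of distinct points, and the conclusion of the open core `stub_poorRigidCore` (= that of `stub_cleanWalk`, skeleton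
`Cruxes/HyperoctahedralThreshold/Lines/refutation_local_symmetry.lean`) asks for a closed colour-walk of the rung graph —
`k + 1` rungs `{p i, q i}`, the colour `col i` carrying rung `i` onto rung `i + 1` as a set, consecutive colours distinct
cyclically — whose rungs are pairwise EQUAL-OR-DISJOINT ("clean") and avoid `R`, with `k + 1 ≤ n^{1/4}`.

Every landed producer of such data (`stub_goodTwin`, `stub_patternTwin`, `twin_cleanWalk`, `CleanReflection.twoPoint_walk`,
`structure_cleanWalk`, `deckTwin_cleanWalk`, `stub_shortEvenCycleGadget`, …) packages ONE rigid shape.  Here the shape is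
replaced by a DENSITY condition.  A **rung system** is a finite set `U` of points with a map `τ` that is a fixed-point-free
involution on `U` (`τ (τ p) = p`, `τ p ∈ U`, `τ p ≠ p` on `U`); its rungs `{p, τ p}` are automatically pairwise
equal-or-disjoint.  Colour `c` is **good** at `p ∈ U` when `μ c p ∈ U` and `τ (μ c p) = μ c (τ p)`: the colour-`c` step
keeps the rung `{p, τ p}` inside the system (an edge or a loop of the rung graph INDUCED on the system).

* `twoCore_cleanWalk` — two distinct good colours at every point (the induced rung graph is its own two-core) and
  `U ∩ R = ∅` give the conclusion of the core verbatim, with `2 (k + 1) ≤ 3 |U|` and all points in `U` (pigeonhole on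
  the states (rung, incoming colour) of the always-continuable non-backtracking walk; no hypothesis on the `μ c`).
* `exists_twoCore` — AVERAGE form: if the `μ c` are involutions and the good incidences `(p, c)` number at least `2 |U|`,
  some nonempty `τ`-invariant `U' ⊆ U` has two distinct good colours (w.r.t. `U'`) at every point (pruning a rung at
  which all good colours coincide kills at most `4` incidences and `2` points; a lone rung violates the count).
* `cleanWalk_of_goodIncidences` = `stub_twoCoreCriterion` — both combined with the real length clause: a rung system on
  `U ⊆ V ∖ R` with `#good incidences ≥ 2|U|` and `3|U| ≤ 2 n^{1/4}` gives the conclusion of `stub_poorRigidCore` verbatim.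

So, up to the constant in the length clause, the open core is EQUIVALENT to: every poor rigid host carries, outside any
`R` with `|R| ≤ n^{3/4}`, a rung system of `O(n^{1/4})` points whose good incidences number at least twice its points — a
DENSITY of commutation of a partial involution with the colours (two of three colours per point on average), not an
exact local symmetry; twins, reflection structures, Möbius cycles, deck translates are the equality cases `#good = 2|U|`.
Pure finite combinatorics; no definitions.  [this line; folklore: minimum degree two forces a closed non-backtracking
walk / the 2-core of a graph with at least as many edges as vertices is nonempty]
-/

-- the project's summit namespace `Summit.MatrixMultiplication.MatrixMultiplication` repeats a component by design (D-0022)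
set_option linter.dupNamespace false

namespace Summit.MatrixMultiplication.MatrixMultiplication.Theorems.HyperoctahedralThreshold

namespace TwoCore

open Finset

variable {n : ℕ}

/-! ### Good colours: symmetry within a rung, propagation along the colour -/

/-- If colour `c` is good at `p` then it is good at the partner `τ p` (rung systems are symmetric). [folklore] -/
theorem good_partner (μ : Fin 3 → Equiv.Perm (Fin n)) (U : Finset (Fin n)) (τ : Fin n → Fin n)
    (hτ : ∀ p ∈ U, τ (τ p) = p) (hτU : ∀ p ∈ U, τ p ∈ U) {p : Fin n} (hp : p ∈ U) {c : Fin 3}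
    (h : μ c p ∈ U ∧ τ (μ c p) = μ c (τ p)) :
    μ c (τ p) ∈ U ∧ τ (μ c (τ p)) = μ c (τ (τ p)) := by
  refine ⟨h.2 ▸ hτU _ h.1, ?_⟩
  rw [← h.2, hτ _ h.1, hτ _ hp]

/-- A good colour propagates along itself: if `c` is good at `x` then `c` is good at `μ c x`
(the `μ c` being involutions). [folklore] -/
theorem good_step (μ : Fin 3 → Equiv.Perm (Fin n)) (hμ : ∀ c, μ c * μ c = 1) (U : Finset (Fin n))
    (τ : Fin n → Fin n) {x : Fin n} (hx : x ∈ U) {c : Fin 3}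
    (h : μ c x ∈ U ∧ τ (μ c x) = μ c (τ x)) :
    μ c (μ c x) ∈ U ∧ τ (μ c (μ c x)) = μ c (τ (μ c x)) := by
  have hinv : ∀ y, μ c (μ c y) = y := fun y => by
    have e := congrArg (fun g : Equiv.Perm (Fin n) => g y) (hμ c)
    simpa using e
  rw [hinv, h.2, hinv]
  exact ⟨hx, rfl⟩

/-- Two rungs of a rung system are equal, equal with the sides exchanged, or disjoint. [folklore] -/
theorem rung_eod (U : Finset (Fin n)) (τ : Fin n → Fin n) (hτ : ∀ p ∈ U, τ (τ p) = p)
    {a b : Fin n} (ha : a ∈ U) (hb : b ∈ U) :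
    (a = b ∧ τ a = τ b) ∨ (a = τ b ∧ τ a = b) ∨ (a ≠ b ∧ a ≠ τ b ∧ τ a ≠ b ∧ τ a ≠ τ b) := by
  by_cases h1 : a = b
  · exact Or.inl ⟨h1, by rw [h1]⟩
  by_cases h2 : a = τ b
  · exact Or.inr (Or.inl ⟨h2, by rw [h2, hτ b hb]⟩)
  refine Or.inr (Or.inr ⟨h1, h2, fun h => h2 ?_, fun h => h1 ?_⟩)
  · rw [← h, hτ a ha]
  · rw [← hτ a ha, h, hτ b hb]

/-! ### The two-core criterion -/

/-- **Two-core criterion.**  A rung system `(U, τ)` (a fixed-point-free involution `τ` on the finite set `U`)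
avoiding `R`, at every point of which two distinct colours are good (`μ c p ∈ U` and `τ (μ c p) = μ c (τ p)`),
carries closed-colour-walk data in the exact format of the conclusion of `stub_poorRigidCore` / `stub_cleanWalk`:
`k + 1` rungs `{p i, q i} = {p i, τ (p i)} ⊆ U`, steps side-preserving or side-exchanging, cyclically distinct
consecutive colours, rungs pairwise equal-or-disjoint, no point in `R`, and `2 (k + 1) ≤ 3 |U|`.  No hypothesis on
the `μ c`. [this line; folklore: minimum degree two forces a closed non-backtracking walk] -/
theorem twoCore_cleanWalk (μ : Fin 3 → Equiv.Perm (Fin n)) (R U : Finset (Fin n)) (τ : Fin n → Fin n)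
    (hτ : ∀ p ∈ U, τ (τ p) = p) (hτU : ∀ p ∈ U, τ p ∈ U) (hτp : ∀ p ∈ U, τ p ≠ p)
    (hUR : Disjoint U R) (hU : U.Nonempty)
    (hdeg : ∀ p ∈ U, ∃ c c' : Fin 3, c ≠ c' ∧ (μ c p ∈ U ∧ τ (μ c p) = μ c (τ p)) ∧
      (μ c' p ∈ U ∧ τ (μ c' p) = μ c' (τ p))) :
    ∃ (k : ℕ) (p q : Fin (k + 1) → Fin n) (col : Fin (k + 1) → Fin 3), (∀ i, p i ≠ q i) ∧
      (∀ i, (μ (col i) (p i) = p (i + 1) ∧ μ (col i) (q i) = q (i + 1)) ∨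
        (μ (col i) (p i) = q (i + 1) ∧ μ (col i) (q i) = p (i + 1))) ∧
      (∀ i, col i ≠ col (i + 1)) ∧
      (∀ i j, (p i = p j ∧ q i = q j) ∨ (p i = q j ∧ q i = p j) ∨
        (p i ≠ p j ∧ p i ≠ q j ∧ q i ≠ p j ∧ q i ≠ q j)) ∧
      (∀ i, p i ∉ R ∧ q i ∉ R) ∧ (∀ i, p i ∈ U ∧ q i = τ (p i)) ∧ 2 * (k + 1) ≤ 3 * U.card := by
  classical
  -- a choice of continuation: at `p ∈ U`, after colour `c`, a good colour `≠ c`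
  have hch : ∀ (p : Fin n) (c : Fin 3), ∃ d : Fin 3, p ∈ U →
      (d ≠ c ∧ μ d p ∈ U ∧ τ (μ d p) = μ d (τ p)) := by
    intro p c
    by_cases hp : p ∈ U
    · obtain ⟨c₁, c₂, hne, h₁, h₂⟩ := hdeg p hp
      by_cases h1 : c₁ = c
      exacts [⟨c₂, fun _ => ⟨fun h => hne (h1.trans h.symm), h₂⟩⟩, ⟨c₁, fun _ => ⟨h1, h₁⟩⟩]
    · exact ⟨c, fun h => absurd h hp⟩
  choose f hf using hch
  obtain ⟨p₀, hp₀⟩ := hU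
  -- the state sequence: (current point, colour used to arrive)
  set s : ℕ → Fin n × Fin 3 :=
    fun m => (fun st : Fin n × Fin 3 => (μ (f st.1 st.2) st.1, f st.1 st.2))^[m] (p₀, 0) with hs_def
  have hs : ∀ m, s (m + 1) = (μ (f (s m).1 (s m).2) (s m).1, f (s m).1 (s m).2) := by
    intro m
    simp only [hs_def]
    rw [Function.iterate_succ_apply']
  have hmem : ∀ m, (s m).1 ∈ U := by
    intro m
    induction m with
    | zero => exact hp₀
    | succ m ih => rw [hs m]; exact (hf _ _ ih).2.1
  have hs1 : ∀ m, μ (s (m + 1)).2 (s m).1 = (s (m + 1)).1 := fun m => by rw [hs m]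
  have hs2 : ∀ m, μ (s (m + 1)).2 (τ (s m).1) = τ (s (m + 1)).1 := fun m => by
    rw [hs m]; exact ((hf _ _ (hmem m)).2.2).symm
  have hcol : ∀ m, (s (m + 1)).2 ≠ (s m).2 := fun m => by rw [hs m]; exact (hf _ _ (hmem m)).1
  -- keys: (smaller end of the current rung, incoming colour)
  set S : Finset (Fin n) := U.filter (fun p => p < τ p) with hS_def
  set key : ℕ → Fin n × Fin 3 := fun m => (min (s m).1 (τ (s m).1), (s m).2) with hkey_def
  have hkey : ∀ m, key m ∈ S ×ˢ (univ : Finset (Fin 3)) := by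
    intro m
    have hm := hmem m
    simp only [hkey_def, hS_def, mem_product, mem_filter, mem_univ, and_true]
    rcases lt_or_gt_of_ne (hτp _ hm).symm with h | h
    · rw [min_eq_left h.le]; exact ⟨hm, h⟩
    · rw [min_eq_right h.le]; refine ⟨hτU _ hm, ?_⟩; rw [hτ _ hm]; exact h
  have h2S : 2 * S.card ≤ U.card := by
    rw [hS_def]
    have h1 : (U.filter (fun p => p < τ p)).card ≤ (U.filter (fun p => ¬ p < τ p)).card := by
      refine card_le_card_of_injOn τ (fun a ha => ?_) (fun a ha b hb h => ?_)
      · have ha' := mem_filter.1 (mem_coe.1 ha)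
        refine mem_coe.2 (mem_filter.2 ⟨hτU a ha'.1, ?_⟩)
        rw [hτ a ha'.1]; exact lt_asymm ha'.2
      · rw [← hτ a (mem_filter.1 (mem_coe.1 ha)).1, h, hτ b (mem_filter.1 (mem_coe.1 hb)).1]
    have h2 := card_filter_add_card_filter_not (s := U) (fun p => p < τ p)
    omega
  -- pigeonhole among the first `3|S| + 1` states
  obtain ⟨i, hi, j, hj, hij, hkij⟩ : ∃ i ∈ range (3 * S.card + 1), ∃ j ∈ range (3 * S.card + 1),
      i ≠ j ∧ key i = key j := by
    apply exists_ne_map_eq_of_card_lt_of_maps_to (t := S ×ˢ (univ : Finset (Fin 3)))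
    · rw [card_product, card_range, card_univ, Fintype.card_fin]; omega
    · intro m _; exact hkey m
  wlog hlt : i < j generalizing i j
  · exact this j hj i hi hij.symm hkij.symm (lt_of_le_of_ne (not_lt.1 hlt) hij.symm)
  have hjM : j ≤ 3 * S.card := by have := mem_range.1 hj; omega
  -- consequences of the key coincidence
  have hcij : (s j).2 = (s i).2 := (congrArg Prod.snd hkij).symm
  have hend : (s j).1 = (s i).1 ∨ (s j).1 = τ (s i).1 := by
    have e : min (s i).1 (τ (s i).1) = min (s j).1 (τ (s j).1) := congrArg Prod.fst hkij
    rcases min_choice (s i).1 (τ (s i).1) with ha | ha <;>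
      rcases min_choice (s j).1 (τ (s j).1) with hb | hb <;> rw [ha, hb] at e
    · exact Or.inl e.symm
    · right; rw [e, hτ _ (hmem j)]
    · exact Or.inr e.symm
    · left; rw [← hτ _ (hmem j), ← e, hτ _ (hmem i)]
  -- the closed walk: states i, i+1, …, j-1 (k + 1 = j - i of them)
  obtain ⟨k, hk⟩ : ∃ k, i + (k + 1) = j := ⟨j - i - 1, by omega⟩
  have hval : ∀ t : Fin (k + 1), ((t + 1 : Fin (k + 1)) : ℕ) = if (t : ℕ) = k then 0 else (t : ℕ) + 1 := by
    intro t
    rw [PatternTwin.val_add_one]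
    split_ifs with h
    · rw [h, Nat.mod_self]
    · exact Nat.mod_eq_of_lt (by have := t.isLt; omega)
  -- the data: `p t = (s (i + t)).1`, `q t = τ (p t)`, `col t = (s (i + t + 1)).2`
  have H1 : ∀ t : Fin (k + 1), (s (i + t)).1 ≠ τ (s (i + t)).1 := fun t => (hτp _ (hmem _)).symm
  have H2 : ∀ t : Fin (k + 1),
      (μ (s (i + t + 1)).2 (s (i + t)).1 = (s (i + ((t + 1 : Fin (k + 1)) : ℕ))).1 ∧
        μ (s (i + t + 1)).2 (τ (s (i + t)).1) = τ (s (i + ((t + 1 : Fin (k + 1)) : ℕ))).1) ∨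
      (μ (s (i + t + 1)).2 (s (i + t)).1 = τ (s (i + ((t + 1 : Fin (k + 1)) : ℕ))).1 ∧
        μ (s (i + t + 1)).2 (τ (s (i + t)).1) = (s (i + ((t + 1 : Fin (k + 1)) : ℕ))).1) := by
    intro t
    by_cases ht : (t : ℕ) = k
    · -- the closing step, from state `j - 1 = i + k` back to state `i`
      have hw : i + ((t + 1 : Fin (k + 1)) : ℕ) = i := by rw [hval t, if_pos ht, Nat.add_zero]
      have ej : i + k + 1 = j := by omega
      rw [hw, ht, hs1 (i + k), hs2 (i + k), ej]
      rcases hend with h | h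
      · exact Or.inl ⟨h, by rw [h]⟩
      · exact Or.inr ⟨h, by rw [h, hτ _ (hmem i)]⟩
    · have e1 : i + ((t + 1 : Fin (k + 1)) : ℕ) = i + (t : ℕ) + 1 := by
        rw [hval t, if_neg ht, Nat.add_assoc]
      rw [e1, hs1, hs2]
      exact Or.inl ⟨rfl, rfl⟩
  have H3 : ∀ t : Fin (k + 1), (s (i + t + 1)).2 ≠ (s (i + ((t + 1 : Fin (k + 1)) : ℕ) + 1)).2 := by
    intro t
    by_cases ht : (t : ℕ) = k
    · have hw : i + ((t + 1 : Fin (k + 1)) : ℕ) = i := by rw [hval t, if_pos ht, Nat.add_zero]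
      have ej : i + k + 1 = j := by omega
      rw [hw, ht, ej, hcij]
      exact (hcol i).symm
    · have e1 : i + ((t + 1 : Fin (k + 1)) : ℕ) = i + (t : ℕ) + 1 := by
        rw [hval t, if_neg ht, Nat.add_assoc]
      rw [e1]
      exact (hcol _).symm
  exact ⟨k, fun t => (s (i + t)).1, fun t => τ (s (i + t)).1, fun t => (s (i + t + 1)).2, H1, H2, H3,
    fun t t' => rung_eod U τ hτ (hmem _) (hmem _),
    fun t => ⟨disjoint_left.1 hUR (hmem _), disjoint_left.1 hUR (hτU _ (hmem _))⟩,
    fun t => ⟨hmem _, rfl⟩, by omega⟩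

/-! ### The average form: enough good incidences force a nonempty two-core -/

/-- **Nonempty two-core.**  If the `μ c` are involutions and the good incidences `(x, c)` (`x ∈ U`, `μ c x ∈ U`,
`τ (μ c x) = μ c (τ x)`) of a rung system `(U, τ)`, `U ≠ ∅`, number at least `2 |U|`, then some nonempty `τ`-invariant
`U' ⊆ U` has two distinct good colours (with respect to `U'`) at every point (prune a rung all of whose good colours
coincide: at most `4` incidences die while `2` points go, and a lone rung violates the count; induct on `|U|`).
[folklore: the 2-core of a graph with `#edges ≥ #vertices` is nonempty] -/
theorem exists_twoCore (μ : Fin 3 → Equiv.Perm (Fin n)) (hμ : ∀ c, μ c * μ c = 1) (τ : Fin n → Fin n) :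
    ∀ U : Finset (Fin n), (∀ p ∈ U, τ (τ p) = p) → (∀ p ∈ U, τ p ∈ U) → U.Nonempty →
      2 * U.card ≤ ((U ×ˢ (univ : Finset (Fin 3))).filter
        (fun xc => μ xc.2 xc.1 ∈ U ∧ τ (μ xc.2 xc.1) = μ xc.2 (τ xc.1))).card →
      ∃ U' ⊆ U, U'.Nonempty ∧ (∀ p ∈ U', τ p ∈ U') ∧
        ∀ p ∈ U', ∃ c c' : Fin 3, c ≠ c' ∧ (μ c p ∈ U' ∧ τ (μ c p) = μ c (τ p)) ∧
          (μ c' p ∈ U' ∧ τ (μ c' p) = μ c' (τ p)) := by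
  classical
  intro U
  induction U using Finset.strongInduction with
  | H U ih =>
  intro hτ hτU hU hE
  by_cases hall : ∀ p ∈ U, ∃ c c' : Fin 3, c ≠ c' ∧ (μ c p ∈ U ∧ τ (μ c p) = μ c (τ p)) ∧
      (μ c' p ∈ U ∧ τ (μ c' p) = μ c' (τ p))
  · exact ⟨U, Subset.refl _, hU, hτU, hall⟩
  -- a point `p` all of whose good colours coincide
  obtain ⟨p, hp, huniq⟩ : ∃ p ∈ U, ∀ c c' : Fin 3, (μ c p ∈ U ∧ τ (μ c p) = μ c (τ p)) →
      (μ c' p ∈ U ∧ τ (μ c' p) = μ c' (τ p)) → c = c' := by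
    by_contra hcon
    apply hall
    intro p hp
    by_contra hp'
    apply hcon
    refine ⟨p, hp, fun c c' hc hc' => ?_⟩
    by_contra hcc
    exact hp' ⟨c, c', hcc, hc, hc'⟩
  -- … and then also at `τ p`
  have huniq' : ∀ x, (x = p ∨ x = τ p) → ∀ c c' : Fin 3, (μ c x ∈ U ∧ τ (μ c x) = μ c (τ x)) →
      (μ c' x ∈ U ∧ τ (μ c' x) = μ c' (τ x)) → c = c' := by
    rintro x (rfl | rfl) c c' hc hc'
    · exact huniq c c' hc hc'
    · have e := hτ p hp
      exact huniq c c' (by simpa only [e] using good_partner μ U τ hτ hτU (hτU p hp) hc)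
        (by simpa only [e] using good_partner μ U τ hτ hτU (hτU p hp) hc')
  -- prune the rung `{p, τ p}`
  set D : Finset (Fin n) := U.filter (fun x => x = p ∨ x = τ p) with hD_def
  set U' : Finset (Fin n) := U.filter (fun x => ¬ (x = p ∨ x = τ p)) with hU'_def
  have hcardU : D.card + U'.card = U.card := card_filter_add_card_filter_not _
  have hU'sub : U' ⊆ U := filter_subset _ _
  have hU'ss : U' ⊂ U := filter_ssubset.2 ⟨p, hp, by simp⟩
  have hτU' : ∀ x ∈ U', τ x ∈ U' := by
    intro x hx
    rw [hU'_def, mem_filter] at hx ⊢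
    refine ⟨hτU x hx.1, ?_⟩
    rintro (h | h)
    · exact hx.2 (Or.inr (by rw [← h, hτ x hx.1]))
    · exact hx.2 (Or.inl (by rw [← hτ x hx.1, h, hτ p hp]))
  have hτ' : ∀ x ∈ U', τ (τ x) = x := fun x hx => hτ x (hU'sub hx)
  -- incidence sets
  set EU := (U ×ˢ (univ : Finset (Fin 3))).filter
    (fun xc => μ xc.2 xc.1 ∈ U ∧ τ (μ xc.2 xc.1) = μ xc.2 (τ xc.1)) with hEU_def
  set EU' := (U' ×ˢ (univ : Finset (Fin 3))).filter
    (fun xc => μ xc.2 xc.1 ∈ U' ∧ τ (μ xc.2 xc.1) = μ xc.2 (τ xc.1)) with hEU'_def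
  set A := EU.filter (fun xc => xc.1 = p ∨ xc.1 = τ p) with hA_def
  set B := EU.filter (fun xc => ¬ (xc.1 = p ∨ xc.1 = τ p) ∧ (μ xc.2 xc.1 = p ∨ μ xc.2 xc.1 = τ p))
    with hB_def
  have hmemEU : ∀ xc, xc ∈ EU ↔ xc.1 ∈ U ∧ μ xc.2 xc.1 ∈ U ∧ τ (μ xc.2 xc.1) = μ xc.2 (τ xc.1) :=
    fun xc => by rw [hEU_def]; simp [mem_filter, mem_product]
  have hmemEU' : ∀ xc, xc ∈ EU' ↔ xc.1 ∈ U' ∧ μ xc.2 xc.1 ∈ U' ∧ τ (μ xc.2 xc.1) = μ xc.2 (τ xc.1) :=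
    fun xc => by rw [hEU'_def]; simp [mem_filter, mem_product]
  -- (1) incidences AT the rung: at most one per end
  have hA : A.card ≤ D.card := by
    refine card_le_card_of_injOn Prod.fst (fun xc hxc => ?_) (fun xc hxc yc hyc h => ?_)
    · have hxc' := mem_filter.1 (mem_coe.1 hxc)
      exact mem_coe.2 (mem_filter.2 ⟨((hmemEU xc).1 hxc'.1).1, hxc'.2⟩)
    · have hxc' := mem_filter.1 (mem_coe.1 hxc)
      have hyc' := mem_filter.1 (mem_coe.1 hyc)
      have hx := (hmemEU xc).1 hxc'.1
      have hy := (hmemEU yc).1 hyc'.1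
      refine Prod.ext h (huniq' xc.1 hxc'.2 xc.2 yc.2 hx.2 ?_)
      have h' : yc.1 = xc.1 := h.symm
      rw [h'] at hy
      exact hy.2
  -- (2) incidences pointing INTO the rung transport to incidences at the rung
  have hB : B.card ≤ A.card := by
    refine card_le_card_of_injOn (fun xc => (μ xc.2 xc.1, xc.2)) (fun xc hxc => ?_)
      (fun xc hxc yc hyc h => ?_)
    · have hxc' := mem_filter.1 (mem_coe.1 hxc)
      have hx := (hmemEU xc).1 hxc'.1
      refine mem_coe.2 (mem_filter.2 ⟨(hmemEU _).2 ⟨hx.2.1, ?_⟩, hxc'.2.2⟩)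
      exact good_step μ hμ U τ hx.1 hx.2
    · obtain ⟨h1, h2⟩ := Prod.mk.inj h
      refine Prod.ext ?_ h2
      rw [← h2] at h1
      exact (μ xc.2).injective h1
  have hB' : B.card ≤ 3 * U'.card := by
    have hsub : B ⊆ U' ×ˢ (univ : Finset (Fin 3)) := by
      intro xc hxc
      have hxc' := mem_filter.1 hxc
      have hx := (hmemEU xc).1 hxc'.1
      exact mem_product.2 ⟨mem_filter.2 ⟨hx.1, hxc'.2.1⟩, mem_univ _⟩
    have := card_le_card hsub
    rw [card_product, card_univ, Fintype.card_fin] at this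
    omega
  have hEU'le : EU'.card ≤ 3 * U'.card := by
    have := card_le_card (filter_subset
      (fun xc => μ xc.2 xc.1 ∈ U' ∧ τ (μ xc.2 xc.1) = μ xc.2 (τ xc.1)) (U' ×ˢ (univ : Finset (Fin 3))))
    rw [card_product, card_univ, Fintype.card_fin] at this
    rw [hEU'_def]
    omega
  -- (3) every other incidence survives in `U'`
  have hcover : EU ⊆ EU' ∪ (A ∪ B) := by
    intro xc hxc
    have hx := (hmemEU xc).1 hxc
    rw [mem_union, mem_union]
    by_cases h1 : xc.1 = p ∨ xc.1 = τ p
    · exact Or.inr (Or.inl (mem_filter.2 ⟨hxc, h1⟩))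
    by_cases h2 : μ xc.2 xc.1 = p ∨ μ xc.2 xc.1 = τ p
    · exact Or.inr (Or.inr (mem_filter.2 ⟨hxc, h1, h2⟩))
    refine Or.inl ((hmemEU' xc).2 ⟨mem_filter.2 ⟨hx.1, h1⟩, mem_filter.2 ⟨hx.2.1, h2⟩, hx.2.2⟩)
  have hcardE : EU.card ≤ EU'.card + A.card + B.card :=
    (card_le_card hcover).trans ((card_union_le _ _).trans (by
      have := card_union_le A B; omega))
  have hUpos : 0 < U.card := card_pos.2 ⟨p, hp⟩
  have hU'ne : U'.Nonempty := by
    rw [← card_pos]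
    omega
  have hE' : 2 * U'.card ≤ EU'.card := by omega
  obtain ⟨U'', hsub'', hne'', hτU'', hdeg''⟩ := ih U' hU'ss hτ' hτU' hU'ne (by rw [hEU'_def] at hE'; exact hE')
  exact ⟨U'', hsub''.trans hU'sub, hne'', hτU'', hdeg''⟩

/-- **The two-core criterion in the format of the open core.**  Three involutions `μ c` of `Fin n`, a forbidden set
`R`, and a rung system `(U, τ)` on `U ⊆ Fin n ∖ R` whose good incidences number at least `2 |U|`, with
`3 |U| ≤ 2 n^{1/4}`: then the conclusion of `stub_poorRigidCore` holds verbatim.  Twin pairs, reflection structures,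
Möbius cycles and deck translates are the equality cases `#good = 2|U|` of the hypothesis. [this line] -/
theorem cleanWalk_of_goodIncidences (μ : Fin 3 → Equiv.Perm (Fin n)) (hμ : ∀ c, μ c * μ c = 1)
    (R U : Finset (Fin n)) (τ : Fin n → Fin n)
    (hτ : ∀ p ∈ U, τ (τ p) = p) (hτU : ∀ p ∈ U, τ p ∈ U) (hτp : ∀ p ∈ U, τ p ≠ p)
    (hUR : Disjoint U R) (hU : U.Nonempty)
    (hE : 2 * U.card ≤ ((U ×ˢ (univ : Finset (Fin 3))).filter
        (fun xc => μ xc.2 xc.1 ∈ U ∧ τ (μ xc.2 xc.1) = μ xc.2 (τ xc.1))).card)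
    (hlen : 3 * (U.card : ℝ) ≤ 2 * (n : ℝ) ^ ((1 : ℝ) / 4)) :
    ∃ (k : ℕ) (p q : Fin (k + 1) → Fin n) (col : Fin (k + 1) → Fin 3), (∀ i, p i ≠ q i) ∧
      (∀ i, (μ (col i) (p i) = p (i + 1) ∧ μ (col i) (q i) = q (i + 1)) ∨
        (μ (col i) (p i) = q (i + 1) ∧ μ (col i) (q i) = p (i + 1))) ∧
      (∀ i, col i ≠ col (i + 1)) ∧
      (∀ i j, (p i = p j ∧ q i = q j) ∨ (p i = q j ∧ q i = p j) ∨
        (p i ≠ p j ∧ p i ≠ q j ∧ q i ≠ p j ∧ q i ≠ q j)) ∧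
      (∀ i, p i ∉ R ∧ q i ∉ R) ∧ ((k : ℝ) + 1) ≤ (n : ℝ) ^ ((1 : ℝ) / 4) := by
  classical
  obtain ⟨U', hsub, hne, hτU', hdeg⟩ := exists_twoCore μ hμ τ U hτ hτU hU hE
  obtain ⟨k, p, q, col, h1, h2, h3, h4, h5, -, h7⟩ :=
    twoCore_cleanWalk μ R U' τ (fun x hx => hτ x (hsub hx)) hτU' (fun x hx => hτp x (hsub hx))
      (disjoint_of_subset_left hsub hUR) hne hdeg
  refine ⟨k, p, q, col, h1, h2, h3, h4, h5, ?_⟩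
  have hc : (U'.card : ℝ) ≤ U.card := by exact_mod_cast card_le_card hsub
  have h7' : (2 : ℝ) * ((k : ℝ) + 1) ≤ 3 * (U'.card : ℝ) := by exact_mod_cast h7
  linarith

end TwoCore

/-- **Registered form `stub_twoCoreCriterion`** (`--supports stmt-MatrixMultiplication-10883`): the two-core criterion
`TwoCore.cleanWalk_of_goodIncidences` as a closed statement — a rung system `(U, τ)` outside `R` whose good incidences
number at least `2 |U|`, with `3 |U| ≤ 2 n^{1/4}`, yields the conclusion of `stub_poorRigidCore` verbatim. [this line] -/
theorem stub_twoCoreCriterion : ∀ (n : ℕ) (μ : Fin 3 → Equiv.Perm (Fin n)), (∀ c, μ c * μ c = 1) →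
    ∀ (R U : Finset (Fin n)) (τ : Fin n → Fin n), (∀ p ∈ U, τ (τ p) = p) → (∀ p ∈ U, τ p ∈ U) →
    (∀ p ∈ U, τ p ≠ p) → Disjoint U R → U.Nonempty →
    2 * U.card ≤ ((U ×ˢ (Finset.univ : Finset (Fin 3))).filter
      (fun xc => μ xc.2 xc.1 ∈ U ∧ τ (μ xc.2 xc.1) = μ xc.2 (τ xc.1))).card →
    3 * (U.card : ℝ) ≤ 2 * (n : ℝ) ^ ((1 : ℝ) / 4) →
    ∃ (k : ℕ) (p q : Fin (k + 1) → Fin n) (col : Fin (k + 1) → Fin 3), (∀ i, p i ≠ q i) ∧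
      (∀ i, (μ (col i) (p i) = p (i + 1) ∧ μ (col i) (q i) = q (i + 1)) ∨
        (μ (col i) (p i) = q (i + 1) ∧ μ (col i) (q i) = p (i + 1))) ∧
      (∀ i, col i ≠ col (i + 1)) ∧
      (∀ i j, (p i = p j ∧ q i = q j) ∨ (p i = q j ∧ q i = p j) ∨
        (p i ≠ p j ∧ p i ≠ q j ∧ q i ≠ p j ∧ q i ≠ q j)) ∧
      (∀ i, p i ∉ R ∧ q i ∉ R) ∧ ((k : ℝ) + 1) ≤ (n : ℝ) ^ ((1 : ℝ) / 4) :=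
  fun _ μ hμ R U τ hτ hτU hτp hUR hU hE hlen =>
    TwoCore.cleanWalk_of_goodIncidences μ hμ R U τ hτ hτU hτp hUR hU hE hlen

end Summit.MatrixMultiplication.MatrixMultiplication.Theorems.HyperoctahedralThreshold
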